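import Summits.AtomisticToContinuum.FouriersLaw.Theorems.LocalOhmBVLocalOhmStubGibbsTermCovarianceDecayAux3
import Summits.AtomisticToContinuum.FouriersLaw.Theorems.HeatModeWeylLawSpecificHeatLimitAssembly

/-!
# Per-term covariance decay for the free finite Gibbs state (stub `stub_gibbsTermCovarianceDecay`),
# helper V: the covariance bound from the Jentzsch gap (abstract one-site space)

Helper file for crux item stmt-AtomisticToContinuum-12009 (`LocalOhmBV.LocalOhm`, line `registered`,
stub T2 `stub_gibbsTermCovarianceDecay`); continuation of `…GibbsTermCovarianceDecayAux1–3`.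

* `abs_det_inner_pow_le` — **the rank-one parts cancel in the covariance determinant**: for a
  bounded operator `A` on a real inner product space whose powers converge to the top
  eigenprojection, `‖Aʲg - λʲ⟪φ, g⟫φ‖ ≤ θʲ‖g‖` (`‖φ‖ = 1`, `0 ≤ θ ≤ λ`; e.g.
  `IsPositivityImproving.exists_norm_pow_sub_le`), and any vectors `g, l, x, y`:
  `|⟪g, Aʲx⟫⟪l, Aʲy⟫ - ⟪g, Aʲy⟫⟪l, Aʲx⟫| ≤ 6 λʲ θʲ ‖g‖‖l‖‖x‖‖y‖`;
* `abs_cov_transfer_le` (**main abstract bound**) — on a finite one-site measure space with the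
  symmetrised transfer data (`a`, `K₀`, `k = aK₀a`, weight `w`), the `L²` transfer operator `A` with
  a Jentzsch gap, a bounded insertion kernel `k · ins` with operator `H`, and a uniform lower bound
  `Z_{n+1} = ⟪[a], Aⁿ[a]⟫ ≥ z_* λⁿ` on the partition functions: for a left observable `Gl` of `e+1`
  sites with `∫ Gl² w_{e+1} ≤ K_G Z_{e+1}` and the insertion on the bond `j` of the right block
  (`m` sites), the normalised covariance of `Gl` and the insertion under `w_{e+1+m} dρ^{⊗(e+1+m)}`
  is at most `24 √K_G · max(4‖[a]‖⁴/λ, 2‖[a]‖²) · ‖H‖ ‖[a]‖² (θ/λ)ʲ / (z_*² λ)` — uniformly in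
  `e`, `m` (representations of `…Aux3`, `memLp_leftVector`; all powers of `λ` cancel). [folklore]
-/

set_option autoImplicit false

noncomputable section

namespace Summit.AtomisticToContinuum.FouriersLaw.Theorems.LocalOhmBirth.TermDecay

open MeasureTheory Filter Topology Function
open scoped BigOperators ENNReal RealInnerProductSpace
open Literature.Analysis.OperatorTheory
open Summit.AtomisticToContinuum.FouriersLaw.Theorems.SpecificHeatLimit

/-! ### The covariance determinant -/

section Abstract

variable {E : Type*} [NormedAddCommGroup E] [InnerProductSpace ℝ E]

/-- Six-term triangle inequality. -/
theorem abs_six_terms_le (p q r s t u : ℝ) :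
    |p + q + r - s - t - u| ≤ |p| + |q| + |r| + |s| + |t| + |u| := by
  calc |p + q + r - s - t - u| ≤ |p + q + r - s - t| + |u| := abs_sub _ _
    _ ≤ |p + q + r - s| + |t| + |u| := by gcongr; exact abs_sub _ _
    _ ≤ |p + q + r| + |s| + |t| + |u| := by gcongr; exact abs_sub _ _
    _ ≤ |p + q| + |r| + |s| + |t| + |u| := by gcongr; exact abs_add_le _ _
    _ ≤ |p| + |q| + |r| + |s| + |t| + |u| := by gcongr; exact abs_add_le _ _

/-- **The rank-one parts cancel in the covariance determinant.** Let `A` be a bounded operator on a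
real inner product space, `φ` a unit vector and suppose `‖Aⁿ g - λⁿ⟪φ, g⟫ φ‖ ≤ θⁿ ‖g‖` for all
`n, g` with `0 < λ`, `0 ≤ θ ≤ λ`. Then for all `j` and `g, l, x, y`:
`|⟪g, Aʲx⟫⟪l, Aʲy⟫ - ⟪g, Aʲy⟫⟪l, Aʲx⟫| ≤ 6 λʲ θʲ ‖g‖ ‖l‖ ‖x‖ ‖y‖`. -/
theorem abs_det_inner_pow_le {A : E →L[ℝ] E} {φ : E} {lam θ : ℝ} (hφ : ‖φ‖ = 1) (hlam : 0 < lam)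
    (hθ0 : 0 ≤ θ) (hθ : θ ≤ lam)
    (hpow : ∀ (n : ℕ) (g : E), ‖(A ^ n) g - (lam ^ n * ⟪φ, g⟫) • φ‖ ≤ θ ^ n * ‖g‖)
    (j : ℕ) (g l x y : E) :
    |⟪g, (A ^ j) x⟫ * ⟪l, (A ^ j) y⟫ - ⟪g, (A ^ j) y⟫ * ⟪l, (A ^ j) x⟫| ≤
      6 * lam ^ j * θ ^ j * (‖g‖ * ‖l‖ * ‖x‖ * ‖y‖) := by
  set εx : E := (A ^ j) x - (lam ^ j * ⟪φ, x⟫) • φ with hεxdef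
  set εy : E := (A ^ j) y - (lam ^ j * ⟪φ, y⟫) • φ with hεydef
  have hεx : ‖εx‖ ≤ θ ^ j * ‖x‖ := hpow j x
  have hεy : ‖εy‖ ≤ θ ^ j * ‖y‖ := hpow j y
  have hAx : (A ^ j) x = (lam ^ j * ⟪φ, x⟫) • φ + εx := by rw [hεxdef]; abel
  have hAy : (A ^ j) y = (lam ^ j * ⟪φ, y⟫) • φ + εy := by rw [hεydef]; abel
  have e1 : ⟪g, (A ^ j) x⟫ = lam ^ j * ⟪φ, x⟫ * ⟪g, φ⟫ + ⟪g, εx⟫ := by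
    rw [hAx, inner_add_right, real_inner_smul_right]
  have e2 : ⟪l, (A ^ j) y⟫ = lam ^ j * ⟪φ, y⟫ * ⟪l, φ⟫ + ⟪l, εy⟫ := by
    rw [hAy, inner_add_right, real_inner_smul_right]
  have e3 : ⟪g, (A ^ j) y⟫ = lam ^ j * ⟪φ, y⟫ * ⟪g, φ⟫ + ⟪g, εy⟫ := by
    rw [hAy, inner_add_right, real_inner_smul_right]
  have e4 : ⟪l, (A ^ j) x⟫ = lam ^ j * ⟪φ, x⟫ * ⟪l, φ⟫ + ⟪l, εx⟫ := by
    rw [hAx, inner_add_right, real_inner_smul_right]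
  rw [e1, e2, e3, e4]
  have hcancel : (lam ^ j * ⟪φ, x⟫ * ⟪g, φ⟫ + ⟪g, εx⟫) * (lam ^ j * ⟪φ, y⟫ * ⟪l, φ⟫ + ⟪l, εy⟫) -
      (lam ^ j * ⟪φ, y⟫ * ⟪g, φ⟫ + ⟪g, εy⟫) * (lam ^ j * ⟪φ, x⟫ * ⟪l, φ⟫ + ⟪l, εx⟫) =
      lam ^ j * ⟪φ, x⟫ * ⟪g, φ⟫ * ⟪l, εy⟫ + lam ^ j * ⟪φ, y⟫ * ⟪l, φ⟫ * ⟪g, εx⟫ +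
        ⟪g, εx⟫ * ⟪l, εy⟫ - lam ^ j * ⟪φ, y⟫ * ⟪g, φ⟫ * ⟪l, εx⟫ -
        lam ^ j * ⟪φ, x⟫ * ⟪l, φ⟫ * ⟪g, εy⟫ - ⟪g, εy⟫ * ⟪l, εx⟫ := by ring
  rw [hcancel]
  -- elementary bounds
  have hx' : |⟪φ, x⟫| ≤ ‖x‖ := (abs_real_inner_le_norm φ x).trans (by rw [hφ, one_mul])
  have hy' : |⟪φ, y⟫| ≤ ‖y‖ := (abs_real_inner_le_norm φ y).trans (by rw [hφ, one_mul])
  have hg' : |⟪g, φ⟫| ≤ ‖g‖ := (abs_real_inner_le_norm g φ).trans (by rw [hφ, mul_one])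
  have hl' : |⟪l, φ⟫| ≤ ‖l‖ := (abs_real_inner_le_norm l φ).trans (by rw [hφ, mul_one])
  have hgεx : |⟪g, εx⟫| ≤ ‖g‖ * (θ ^ j * ‖x‖) :=
    (abs_real_inner_le_norm _ _).trans (mul_le_mul_of_nonneg_left hεx (norm_nonneg _))
  have hgεy : |⟪g, εy⟫| ≤ ‖g‖ * (θ ^ j * ‖y‖) :=
    (abs_real_inner_le_norm _ _).trans (mul_le_mul_of_nonneg_left hεy (norm_nonneg _))
  have hlεx : |⟪l, εx⟫| ≤ ‖l‖ * (θ ^ j * ‖x‖) :=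
    (abs_real_inner_le_norm _ _).trans (mul_le_mul_of_nonneg_left hεx (norm_nonneg _))
  have hlεy : |⟪l, εy⟫| ≤ ‖l‖ * (θ ^ j * ‖y‖) :=
    (abs_real_inner_le_norm _ _).trans (mul_le_mul_of_nonneg_left hεy (norm_nonneg _))
  have hlj : 0 < lam ^ j := pow_pos hlam j
  have hθj : 0 ≤ θ ^ j := pow_nonneg hθ0 j
  have hθθ : θ ^ j * θ ^ j ≤ lam ^ j * θ ^ j :=
    mul_le_mul_of_nonneg_right (pow_le_pow_left₀ hθ0 hθ j) hθj
  set M : ℝ := lam ^ j * θ ^ j * (‖g‖ * ‖l‖ * ‖x‖ * ‖y‖) with hM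
  have hGLXY : 0 ≤ ‖g‖ * ‖l‖ * ‖x‖ * ‖y‖ := by positivity
  have t1 : |lam ^ j * ⟪φ, x⟫ * ⟪g, φ⟫ * ⟪l, εy⟫| ≤ M := by
    rw [abs_mul, abs_mul, abs_mul, abs_of_pos hlj]
    calc lam ^ j * |⟪φ, x⟫| * |⟪g, φ⟫| * |⟪l, εy⟫| ≤ lam ^ j * ‖x‖ * ‖g‖ * (‖l‖ * (θ ^ j * ‖y‖)) := by
          gcongr
      _ = M := by rw [hM]; ring
  have t2 : |lam ^ j * ⟪φ, y⟫ * ⟪l, φ⟫ * ⟪g, εx⟫| ≤ M := by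
    rw [abs_mul, abs_mul, abs_mul, abs_of_pos hlj]
    calc lam ^ j * |⟪φ, y⟫| * |⟪l, φ⟫| * |⟪g, εx⟫| ≤ lam ^ j * ‖y‖ * ‖l‖ * (‖g‖ * (θ ^ j * ‖x‖)) := by
          gcongr
      _ = M := by rw [hM]; ring
  have t3 : |⟪g, εx⟫ * ⟪l, εy⟫| ≤ M := by
    rw [abs_mul]
    calc |⟪g, εx⟫| * |⟪l, εy⟫| ≤ (‖g‖ * (θ ^ j * ‖x‖)) * (‖l‖ * (θ ^ j * ‖y‖)) :=
          mul_le_mul hgεx hlεy (abs_nonneg _) (by positivity)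
      _ = (θ ^ j * θ ^ j) * (‖g‖ * ‖l‖ * ‖x‖ * ‖y‖) := by ring
      _ ≤ (lam ^ j * θ ^ j) * (‖g‖ * ‖l‖ * ‖x‖ * ‖y‖) := mul_le_mul_of_nonneg_right hθθ hGLXY
      _ = M := by rw [hM]
  have t4 : |lam ^ j * ⟪φ, y⟫ * ⟪g, φ⟫ * ⟪l, εx⟫| ≤ M := by
    rw [abs_mul, abs_mul, abs_mul, abs_of_pos hlj]
    calc lam ^ j * |⟪φ, y⟫| * |⟪g, φ⟫| * |⟪l, εx⟫| ≤ lam ^ j * ‖y‖ * ‖g‖ * (‖l‖ * (θ ^ j * ‖x‖)) := by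
          gcongr
      _ = M := by rw [hM]; ring
  have t5 : |lam ^ j * ⟪φ, x⟫ * ⟪l, φ⟫ * ⟪g, εy⟫| ≤ M := by
    rw [abs_mul, abs_mul, abs_mul, abs_of_pos hlj]
    calc lam ^ j * |⟪φ, x⟫| * |⟪l, φ⟫| * |⟪g, εy⟫| ≤ lam ^ j * ‖x‖ * ‖l‖ * (‖g‖ * (θ ^ j * ‖y‖)) := by
          gcongr
      _ = M := by rw [hM]; ring
  have t6 : |⟪g, εy⟫ * ⟪l, εx⟫| ≤ M := by
    rw [abs_mul]
    calc |⟪g, εy⟫| * |⟪l, εx⟫| ≤ (‖g‖ * (θ ^ j * ‖y‖)) * (‖l‖ * (θ ^ j * ‖x‖)) :=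
          mul_le_mul hgεy hlεx (abs_nonneg _) (by positivity)
      _ = (θ ^ j * θ ^ j) * (‖g‖ * ‖l‖ * ‖x‖ * ‖y‖) := by ring
      _ ≤ (lam ^ j * θ ^ j) * (‖g‖ * ‖l‖ * ‖x‖ * ‖y‖) := mul_le_mul_of_nonneg_right hθθ hGLXY
      _ = M := by rw [hM]
  refine (abs_six_terms_le _ _ _ _ _ _).trans ?_
  have : 6 * lam ^ j * θ ^ j * (‖g‖ * ‖l‖ * ‖x‖ * ‖y‖) = 6 * M := by rw [hM]; ring
  rw [this]
  linarith

/-- `x/y - (x'/y)(x''/y) = (x y - x' x'')/y²` for `y ≠ 0`. -/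
theorem div_sub_div_mul_div_eq {x x' x'' y : ℝ} (hy : y ≠ 0) :
    x / y - x' / y * (x'' / y) = (x * y - x' * x'') / y ^ 2 := by
  field_simp

end Abstract

/-! ### The main abstract covariance bound -/

section Main

variable {Y : Type*} [MeasurableSpace Y] {ρ : Measure Y} [IsFiniteMeasure ρ]
variable {a : Y → ℝ} {K₀ k : Y → Y → ℝ} {w : (N : ℕ) → (Fin N → Y) → ℝ}

omit [IsFiniteMeasure ρ] in
/-- The squared norm of the `L²` class of a square-integrable function is the integral of its
square. -/
theorem norm_toLp_sq_eq_integral_sq {f : Y → ℝ} (hf : MemLp f 2 ρ) :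
    ‖hf.toLp f‖ ^ 2 = ∫ x, f x ^ 2 ∂ρ := by
  rw [← real_inner_self_eq_norm_sq, inner_eq_integral]
  refine integral_congr_ae ?_
  filter_upwards [hf.coeFn_toLp] with x hx
  rw [hx, sq]

set_option maxHeartbeats 1600000 in
/-- **Covariance bound from the Jentzsch gap (abstract one-site space).** See the module docstring:
the normalised covariance, under `w_{e+1+m} dρ^{⊗(e+1+m)}`, of a left observable `Gl` (first `e+1`
sites, `∫ Gl² w_{e+1} ≤ K_G ∫ w_{e+1}`) and an insertion `ins` on the bond `j` of the right block is
at most `24 √K_G · max(4‖[a]‖⁴/λ, 2‖[a]‖²) · ‖H‖ ‖[a]‖² (θ/λ)ʲ / (z_*² λ)`. The three observables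
`FGI = Gl · ins`, `FG = Gl`, `FI = ins` of the long chain enter through their values on glued
configurations. -/
theorem abs_cov_transfer_le (hk : ∀ x y, k x y = a x * K₀ x y * a y)
    (hw : ∀ (N : ℕ) (ζ : Fin N → Y), w N ζ = (∏ i, a (ζ i) ^ 2) *
      ∏ i : Fin N, ∏ j : Fin N, if j.val = i.val + 1 then K₀ (ζ i) (ζ j) else 1)
    (ha0 : ∀ x, 0 < a x) (hab : ∀ x, ‖a x‖ ≤ 1) (hK0 : ∀ x y, 0 ≤ K₀ x y) (hK1 : ∀ x y, K₀ x y ≤ 1)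
    (ham : Measurable a) (hkm : Measurable (uncurry k)) {C : ℝ} (hkC : ∀ x y, ‖k x y‖ ≤ C)
    {ins : Y → Y → ℝ} (hkim : Measurable (uncurry fun x y => k x y * ins x y))
    (hkiC : ∀ x y, ‖k x y * ins x y‖ ≤ C)
    {A H : Lp ℝ 2 ρ →L[ℝ] Lp ℝ 2 ρ}
    (hA : ∀ ψ : Lp ℝ 2 ρ, (A ψ : Y → ℝ) =ᵐ[ρ] fun x => ∫ y, k x y * ψ y ∂ρ)
    (hH : ∀ ψ : Lp ℝ 2 ρ, (H ψ : Y → ℝ) =ᵐ[ρ] fun x => ∫ y, (k x y * ins x y) * ψ y ∂ρ)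
    {φ : Lp ℝ 2 ρ} {lam θ : ℝ} (hφ : ‖φ‖ = 1) (hlam : 0 < lam) (hθ0 : 0 ≤ θ) (hθ : θ ≤ lam)
    (hpow : ∀ (n : ℕ) (g : Lp ℝ 2 ρ), ‖(A ^ n) g - (lam ^ n * ⟪φ, g⟫) • φ‖ ≤ θ ^ n * ‖g‖)
    {zs : ℝ} (hzs : 0 < zs)
    (hz : ∀ n : ℕ, zs * lam ^ n ≤
      ⟪(memLp_two_of_bound (μ := ρ) ham hab).toLp a, (A ^ n) ((memLp_two_of_bound (μ := ρ) ham hab).toLp a)⟫)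
    (e m : ℕ) (j : Fin m)
    {Gl : (Fin (e + 1) → Y) → ℝ} (hGl : Measurable Gl) {KG : ℝ} (hKG0 : 0 ≤ KG)
    (hIG : Integrable (fun ξ => Gl ξ ^ 2 * w (e + 1) ξ) (Measure.pi fun _ : Fin (e + 1) => ρ))
    (hKG : ∫ ξ, Gl ξ ^ 2 * w (e + 1) ξ ∂(Measure.pi fun _ : Fin (e + 1) => ρ) ≤
      KG * ∫ ξ, w (e + 1) ξ ∂(Measure.pi fun _ : Fin (e + 1) => ρ))
    (hwe : Integrable (w e) (Measure.pi fun _ : Fin e => ρ))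
    (hwl : Integrable (w (e + 1)) (Measure.pi fun _ : Fin (e + 1) => ρ))
    (hwN : Integrable (w (e + 1 + m)) (Measure.pi fun _ : Fin (e + 1 + m) => ρ))
    {FGI FG FI : (Fin (e + 1 + m) → Y) → ℝ}
    (hFGI : ∀ ξ η, FGI (Fin.append ξ η) =
      Gl ξ * ins ((Fin.cons (ξ (Fin.last e)) η : Fin (m + 1) → Y) (Fin.castSucc j)) (η j))
    (hFG : ∀ ξ η, FG (Fin.append ξ η) = Gl ξ)
    (hFI : ∀ ξ η, FI (Fin.append ξ η) =
      ins ((Fin.cons (ξ (Fin.last e)) η : Fin (m + 1) → Y) (Fin.castSucc j)) (η j))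
    (hFGIi : Integrable (fun ζ => FGI ζ * w (e + 1 + m) ζ) (Measure.pi fun _ : Fin (e + 1 + m) => ρ))
    (hFGi : Integrable (fun ζ => FG ζ * w (e + 1 + m) ζ) (Measure.pi fun _ : Fin (e + 1 + m) => ρ))
    (hFIi : Integrable (fun ζ => FI ζ * w (e + 1 + m) ζ) (Measure.pi fun _ : Fin (e + 1 + m) => ρ)) :
    |(∫ ζ, FGI ζ * w (e + 1 + m) ζ ∂(Measure.pi fun _ : Fin (e + 1 + m) => ρ)) /
        (∫ ζ, w (e + 1 + m) ζ ∂(Measure.pi fun _ : Fin (e + 1 + m) => ρ)) -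
      (∫ ζ, FG ζ * w (e + 1 + m) ζ ∂(Measure.pi fun _ : Fin (e + 1 + m) => ρ)) /
        (∫ ζ, w (e + 1 + m) ζ ∂(Measure.pi fun _ : Fin (e + 1 + m) => ρ)) *
      ((∫ ζ, FI ζ * w (e + 1 + m) ζ ∂(Measure.pi fun _ : Fin (e + 1 + m) => ρ)) /
        (∫ ζ, w (e + 1 + m) ζ ∂(Measure.pi fun _ : Fin (e + 1 + m) => ρ)))| ≤
      24 * Real.sqrt KG * max (4 * ‖(memLp_two_of_bound (μ := ρ) ham hab).toLp a‖ ^ 4 / lam)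
          (2 * ‖(memLp_two_of_bound (μ := ρ) ham hab).toLp a‖ ^ 2) * ‖H‖ *
        ‖(memLp_two_of_bound (μ := ρ) ham hab).toLp a‖ ^ 2 * (θ / lam) ^ (j : ℕ) / (zs ^ 2 * lam) := by
  set b : Lp ℝ 2 ρ := (memLp_two_of_bound (μ := ρ) ham hab).toLp a with hb
  set jn : ℕ := (j : ℕ) with hjn
  obtain ⟨p, hp⟩ : ∃ p, m = jn + 1 + p := ⟨m - jn - 1, by have := j.isLt; omega⟩
  have hw0 : ∀ (N : ℕ) (ζ : Fin N → Y), 0 ≤ w N ζ := fun N ζ => w_nonneg hw hK0 N ζ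
  -- ### right vectors
  obtain ⟨RI, hRI, -, -, hRIW⟩ := exists_rightVector (ρ := ρ) ham hab hkm hkC hkim hkiC hA hH m j
  obtain ⟨R1, hR1, -, -, hR1W⟩ := exists_rightVector_one (ρ := ρ) ham hab hkm hkC hA m
  -- ### left vectors
  obtain ⟨Ĝ, hĜ⟩ : ∃ Ĝ : Y → ℝ, ∀ x, Ĝ x = ∫ ξ', Gl (Fin.snoc ξ' x) *
      (a ((Fin.snoc ξ' x : Fin (e + 1) → Y) 0) *
        ∏ i : Fin e, k ((Fin.snoc ξ' x : Fin (e + 1) → Y) (Fin.castSucc i))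
          ((Fin.snoc ξ' x : Fin (e + 1) → Y) i.succ)) ∂(Measure.pi fun _ : Fin e => ρ) := ⟨_, fun _ => rfl⟩
  obtain ⟨hĜ2, hĜn⟩ := memLp_leftVector ρ hk hw ha0 hK0 hK1 ham hkm e hGl hIG hwe hĜ
  obtain ⟨Lh, hLh⟩ : ∃ Lh : Y → ℝ, ∀ x, Lh x = ∫ ξ', (fun _ : Fin (e + 1) → Y => (1 : ℝ)) (Fin.snoc ξ' x) *
      (a ((Fin.snoc ξ' x : Fin (e + 1) → Y) 0) *
        ∏ i : Fin e, k ((Fin.snoc ξ' x : Fin (e + 1) → Y) (Fin.castSucc i))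
          ((Fin.snoc ξ' x : Fin (e + 1) → Y) i.succ)) ∂(Measure.pi fun _ : Fin e => ρ) := ⟨_, fun _ => rfl⟩
  have hI1 : Integrable (fun ξ => (fun _ : Fin (e + 1) → Y => (1 : ℝ)) ξ ^ 2 * w (e + 1) ξ)
      (Measure.pi fun _ : Fin (e + 1) => ρ) := hwl.congr (ae_of_all _ fun ξ => by simp)
  obtain ⟨hLh2, hLhn⟩ := memLp_leftVector ρ hk hw ha0 hK0 hK1 ham hkm e measurable_const hI1 hwe hLh
  -- ### the four representations
  have hP1 : ∫ ζ, FGI ζ * w (e + 1 + m) ζ ∂(Measure.pi fun _ : Fin (e + 1 + m) => ρ) =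
      ⟪hĜ2.toLp Ĝ, (A ^ jn * H * A ^ (m - 1 - jn)) b⟫ :=
    integral_mul_w_eq_inner hk hw e m
      (Fr := fun u η => ins ((Fin.cons u η : Fin (m + 1) → Y) (Fin.castSucc j)) (η j))
      hFGI hFGIi hRI hRIW hĜ hĜ2
  have hP2 : ∫ ζ, FG ζ * w (e + 1 + m) ζ ∂(Measure.pi fun _ : Fin (e + 1 + m) => ρ) =
      ⟪hĜ2.toLp Ĝ, (A ^ m) b⟫ :=
    integral_mul_w_eq_inner hk hw e m (Fr := fun (_ : Y) (_ : Fin m → Y) => (1 : ℝ))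
      (fun ξ η => by rw [hFG]; simp) hFGi (R := R1) (fun u => by rw [hR1]; simp) hR1W hĜ hĜ2
  have hP3 : ∫ ζ, FI ζ * w (e + 1 + m) ζ ∂(Measure.pi fun _ : Fin (e + 1 + m) => ρ) =
      ⟪hLh2.toLp Lh, (A ^ jn * H * A ^ (m - 1 - jn)) b⟫ :=
    integral_mul_w_eq_inner hk hw e m (Gl := fun _ : Fin (e + 1) → Y => (1 : ℝ))
      (Fr := fun u η => ins ((Fin.cons u η : Fin (m + 1) → Y) (Fin.castSucc j)) (η j))
      (fun ξ η => by rw [hFI]; simp) hFIi hRI hRIW hLh hLh2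
  have hP4' : ∫ ζ, (fun _ : Fin (e + 1 + m) → Y => (1 : ℝ)) ζ * w (e + 1 + m) ζ
      ∂(Measure.pi fun _ : Fin (e + 1 + m) => ρ) = ⟪hLh2.toLp Lh, (A ^ m) b⟫ :=
    integral_mul_w_eq_inner hk hw e m (Gl := fun _ : Fin (e + 1) → Y => (1 : ℝ))
      (Fr := fun (_ : Y) (_ : Fin m → Y) => (1 : ℝ)) (F := fun _ => (1 : ℝ))
      (fun ξ η => by simp) (hwN.congr (ae_of_all _ fun ζ => by simp)) (R := R1)
      (fun u => by rw [hR1]; simp) hR1W hLh hLh2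
  have hP4 : ∫ ζ, w (e + 1 + m) ζ ∂(Measure.pi fun _ : Fin (e + 1 + m) => ρ) = ⟪hLh2.toLp Lh, (A ^ m) b⟫ := by
    rw [← hP4']; simp
  -- ### partition functions
  have hZN : ∫ ζ, w (e + 1 + m) ζ ∂(Measure.pi fun _ : Fin (e + 1 + m) => ρ) = ⟪b, (A ^ (e + m)) b⟫ := by
    have := integral_w_eq_inner_pow (ρ := ρ) hk hw ham hab hkm hkC hA (M := e + 1 + m) (by omega) hwN
    rwa [show e + 1 + m - 1 = e + m by omega] at this
  have hZNlow : zs * lam ^ (e + m) ≤ ∫ ζ, w (e + 1 + m) ζ ∂(Measure.pi fun _ : Fin (e + 1 + m) => ρ) := by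
    rw [hZN]; exact hz _
  have hZNpos : 0 < ∫ ζ, w (e + 1 + m) ζ ∂(Measure.pi fun _ : Fin (e + 1 + m) => ρ) :=
    lt_of_lt_of_le (by positivity) hZNlow
  set Ze : ℝ := ∫ ξ', w e ξ' ∂(Measure.pi fun _ : Fin e => ρ) with hZe
  set Zl : ℝ := ∫ ξ, w (e + 1) ξ ∂(Measure.pi fun _ : Fin (e + 1) => ρ) with hZl
  have hZe0 : 0 ≤ Ze := integral_nonneg fun ξ' => hw0 e ξ'
  have hZl0 : 0 ≤ Zl := integral_nonneg fun ξ => hw0 _ ξ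
  have hpowle : ∀ n : ℕ, ⟪b, (A ^ n) b⟫ ≤ 2 * lam ^ n * ‖b‖ ^ 2 := fun n =>
    calc ⟪b, (A ^ n) b⟫ ≤ ‖b‖ * ‖(A ^ n) b‖ := real_inner_le_norm _ _
      _ ≤ ‖b‖ * (2 * lam ^ n * ‖b‖) :=
          mul_le_mul_of_nonneg_left (norm_pow_apply_le_two_mul_pow hφ hlam hθ0 hθ hpow n) (norm_nonneg _)
      _ = 2 * lam ^ n * ‖b‖ ^ 2 := by ring
  have hZl_le : Zl ≤ 2 * lam ^ e * ‖b‖ ^ 2 := by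
    have := integral_w_eq_inner_pow (ρ := ρ) hk hw ham hab hkm hkC hA (M := e + 1) (Nat.succ_pos e) hwl
    rw [Nat.add_sub_cancel] at this
    rw [hZl, this]
    exact hpowle e
  set BZ : ℝ := max (4 * ‖b‖ ^ 4 / lam) (2 * ‖b‖ ^ 2) with hBZ
  have hBZ0 : 0 ≤ BZ := le_max_of_le_right (by positivity)
  have hZeZl : Ze * Zl ≤ BZ * lam ^ (2 * e) := by
    rcases Nat.eq_zero_or_pos e with he | he
    · -- `e = 0`: `Z_0 = 1`
      have hZe1 : Ze = 1 := by
        rw [hZe]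
        have : (fun ξ' : Fin e → Y => w e ξ') = fun _ => (1 : ℝ) := by
          funext ξ'; subst he; exact w_zero hw ξ'
        rw [this, integral_const, measureReal_def]
        subst he
        rw [Measure.pi_empty_univ, ENNReal.toReal_one, one_smul]
      rw [hZe1, one_mul]
      calc Zl ≤ 2 * lam ^ e * ‖b‖ ^ 2 := hZl_le
        _ = 2 * ‖b‖ ^ 2 * lam ^ (2 * e) := by rw [he]; ring
        _ ≤ BZ * lam ^ (2 * e) := mul_le_mul_of_nonneg_right (le_max_right _ _) (by positivity)
    · obtain ⟨e', rfl⟩ : ∃ e', e = e' + 1 := ⟨e - 1, by omega⟩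
      have hZe_le : Ze ≤ 2 * lam ^ e' * ‖b‖ ^ 2 := by
        have := integral_w_eq_inner_pow (ρ := ρ) hk hw ham hab hkm hkC hA (M := e' + 1) (Nat.succ_pos e') hwe
        rw [Nat.add_sub_cancel] at this
        rw [hZe, this]
        exact hpowle e'
      calc Ze * Zl ≤ (2 * lam ^ e' * ‖b‖ ^ 2) * (2 * lam ^ (e' + 1) * ‖b‖ ^ 2) :=
            mul_le_mul hZe_le hZl_le hZl0 (by positivity)
        _ = (4 * ‖b‖ ^ 4 / lam) * lam ^ (2 * (e' + 1)) := by
            field_simp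
            ring
        _ ≤ BZ * lam ^ (2 * (e' + 1)) := mul_le_mul_of_nonneg_right (le_max_left _ _) (by positivity)
  -- ### norms of the left vectors
  have hgn : ‖hĜ2.toLp Ĝ‖ ^ 2 ≤ Ze * (KG * Zl) := by
    rw [norm_toLp_sq_eq_integral_sq hĜ2]
    exact hĜn.trans (mul_le_mul_of_nonneg_left hKG hZe0)
  have hln : ‖hLh2.toLp Lh‖ ^ 2 ≤ Ze * Zl := by
    rw [norm_toLp_sq_eq_integral_sq hLh2]
    refine hLhn.trans (le_of_eq ?_)
    rw [hZl]
    congr 1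
    exact integral_congr_ae (ae_of_all _ fun ξ => by simp)
  have hgl : ‖hĜ2.toLp Ĝ‖ * ‖hLh2.toLp Lh‖ ≤ Real.sqrt KG * (Ze * Zl) := by
    have h1 : (‖hĜ2.toLp Ĝ‖ * ‖hLh2.toLp Lh‖) ^ 2 ≤ (Real.sqrt KG * (Ze * Zl)) ^ 2 := by
      rw [mul_pow, mul_pow, Real.sq_sqrt hKG0]
      calc ‖hĜ2.toLp Ĝ‖ ^ 2 * ‖hLh2.toLp Lh‖ ^ 2 ≤ (Ze * (KG * Zl)) * (Ze * Zl) :=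
            mul_le_mul hgn hln (sq_nonneg _) (by positivity)
        _ = KG * (Ze * Zl) ^ 2 := by ring
    exact le_of_pow_le_pow_left₀ two_ne_zero (by positivity) h1
  have hgl' : ‖hĜ2.toLp Ĝ‖ * ‖hLh2.toLp Lh‖ ≤ Real.sqrt KG * BZ * lam ^ (2 * e) := by
    calc _ ≤ Real.sqrt KG * (Ze * Zl) := hgl
      _ ≤ Real.sqrt KG * (BZ * lam ^ (2 * e)) := mul_le_mul_of_nonneg_left hZeZl (Real.sqrt_nonneg _)
      _ = _ := by ring
  -- ### the vectors `x = H A^p [a]`, `y = A^{p+1} [a]`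
  set xv : Lp ℝ 2 ρ := H ((A ^ p) b) with hxv
  set yv : Lp ℝ 2 ρ := (A ^ (p + 1)) b with hyv
  have hux : (A ^ jn * H * A ^ (m - 1 - jn)) b = (A ^ jn) xv := by
    rw [hxv, show m - 1 - jn = p by omega, mul_apply_eq_comp, mul_apply_eq_comp]
  have hry : (A ^ m) b = (A ^ jn) yv := by
    rw [hyv, show m = jn + (p + 1) by omega, pow_add, mul_apply_eq_comp]
  have hxn : ‖xv‖ ≤ ‖H‖ * (2 * lam ^ p * ‖b‖) :=
    (H.le_opNorm _).trans (mul_le_mul_of_nonneg_left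
      (norm_pow_apply_le_two_mul_pow hφ hlam hθ0 hθ hpow p) (norm_nonneg _))
  have hyn : ‖yv‖ ≤ 2 * lam ^ (p + 1) * ‖b‖ := norm_pow_apply_le_two_mul_pow hφ hlam hθ0 hθ hpow (p + 1)
  rw [hux] at hP1 hP3
  rw [hry] at hP2 hP4
  -- ### the determinant bound
  have hdet := abs_det_inner_pow_le hφ hlam hθ0 hθ hpow jn (hĜ2.toLp Ĝ) (hLh2.toLp Lh) xv yv
  -- ### division
  rw [div_sub_div_mul_div_eq hZNpos.ne', abs_div, abs_of_pos (pow_pos hZNpos 2),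
    div_le_iff₀ (pow_pos hZNpos 2), hP1, hP2, hP3]
  have hlamm : lam ^ (e + m) = lam ^ (e + p + 1) * lam ^ jn := by
    rw [show e + m = (e + p + 1) + jn by omega, pow_add]
  have hRHS0 : 0 ≤ 24 * Real.sqrt KG * BZ * ‖H‖ * ‖b‖ ^ 2 * (θ / lam) ^ jn / (zs ^ 2 * lam) := by
    positivity
  calc |⟪hĜ2.toLp Ĝ, (A ^ jn) xv⟫ * ∫ ζ, w (e + 1 + m) ζ ∂(Measure.pi fun _ : Fin (e + 1 + m) => ρ) -
        ⟪hĜ2.toLp Ĝ, (A ^ jn) yv⟫ * ⟪hLh2.toLp Lh, (A ^ jn) xv⟫|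
      = |⟪hĜ2.toLp Ĝ, (A ^ jn) xv⟫ * ⟪hLh2.toLp Lh, (A ^ jn) yv⟫ -
          ⟪hĜ2.toLp Ĝ, (A ^ jn) yv⟫ * ⟪hLh2.toLp Lh, (A ^ jn) xv⟫| := by rw [hP4]
    _ ≤ 6 * lam ^ jn * θ ^ jn * (‖hĜ2.toLp Ĝ‖ * ‖hLh2.toLp Lh‖ * ‖xv‖ * ‖yv‖) := hdet
    _ ≤ 6 * lam ^ jn * θ ^ jn * ((Real.sqrt KG * BZ * lam ^ (2 * e)) * (‖H‖ * (2 * lam ^ p * ‖b‖)) *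
          (2 * lam ^ (p + 1) * ‖b‖)) := by
        refine mul_le_mul_of_nonneg_left ?_ (by positivity)
        exact mul_le_mul (mul_le_mul hgl' hxn (norm_nonneg _) (by positivity)) hyn (norm_nonneg _)
          (by positivity)
    _ = (24 * Real.sqrt KG * BZ * ‖H‖ * ‖b‖ ^ 2 * (θ / lam) ^ jn / (zs ^ 2 * lam)) *
          (zs * lam ^ (e + m)) ^ 2 := by
        have hlam0 : lam ≠ 0 := hlam.ne'
        have hzs0 : zs ≠ 0 := hzs.ne'
        have hLj : lam ^ jn ≠ 0 := pow_ne_zero _ hlam0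
        rw [hlamm, div_pow, show lam ^ (2 * e) = (lam ^ e) ^ 2 by ring,
          show lam ^ (e + p + 1) = lam ^ e * lam ^ p * lam by rw [pow_succ, pow_add],
          show lam ^ (p + 1) = lam ^ p * lam by rw [pow_succ]]
        generalize lam ^ e = Le
        generalize lam ^ p = Lp
        generalize hLj' : lam ^ jn = Lj
        rw [hLj'] at hLj
        generalize θ ^ jn = Tj
        field_simp
        ring
    _ ≤ (24 * Real.sqrt KG * BZ * ‖H‖ * ‖b‖ ^ 2 * (θ / lam) ^ jn / (zs ^ 2 * lam)) *
          (∫ ζ, w (e + 1 + m) ζ ∂(Measure.pi fun _ : Fin (e + 1 + m) => ρ)) ^ 2 := by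
        refine mul_le_mul_of_nonneg_left ?_ hRHS0
        exact pow_le_pow_left₀ (by positivity) hZNlow 2

end Main


/-- **Headline (registered helper stub).** The rank-one parts cancel in the covariance determinant
of a transfer operator with a Jentzsch gap on `L²` of a one-site phase space: with
`‖Aⁿ g - λⁿ⟪φ, g⟫ φ‖ ≤ θⁿ ‖g‖` (`‖φ‖ = 1`, `0 ≤ θ ≤ λ`),
`|⟪g, Aʲx⟫⟪l, Aʲy⟫ - ⟪g, Aʲy⟫⟪l, Aʲx⟫| ≤ 6 λʲ θʲ ‖g‖ ‖l‖ ‖x‖ ‖y‖`. -/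
theorem covDeterminant_rankOne_cancel :
    ∀ (ρ : Measure (ℝ × ℝ)) (A : Lp ℝ 2 ρ →L[ℝ] Lp ℝ 2 ρ) (φ : Lp ℝ 2 ρ) (lam θ : ℝ),
      ‖φ‖ = 1 → 0 < lam → 0 ≤ θ → θ ≤ lam →
      (∀ (n : ℕ) (g : Lp ℝ 2 ρ), ‖(A ^ n) g - (lam ^ n * ⟪φ, g⟫) • φ‖ ≤ θ ^ n * ‖g‖) →
      ∀ (j : ℕ) (g l x y : Lp ℝ 2 ρ),
        |⟪g, (A ^ j) x⟫ * ⟪l, (A ^ j) y⟫ - ⟪g, (A ^ j) y⟫ * ⟪l, (A ^ j) x⟫| ≤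
          6 * lam ^ j * θ ^ j * (‖g‖ * ‖l‖ * ‖x‖ * ‖y‖) := by
  intro ρ A φ lam θ hφ hlam hθ0 hθ hpow j g l x y
  exact abs_det_inner_pow_le hφ hlam hθ0 hθ hpow j g l x y

end Summit.AtomisticToContinuum.FouriersLaw.Theorems.LocalOhmBirth.TermDecay

end
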